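import Summits.ResolutionOfSingularities.ResolutionOfSingularities.Theorems.FrobeniusClosingPatchingRelPerfectDepthTwoSeparation
import Summits.ResolutionOfSingularities.ResolutionOfSingularities.Theorems.FrobeniusClosingPatchingRelPerfectDepthOneDictionaryStepHolds
import Summits.ResolutionOfSingularities.ResolutionOfSingularities.Theorems.FrobeniusClosingPatchingRelPerfectDepthOneTowerContractionHolds
import Summits.ResolutionOfSingularities.ResolutionOfSingularities.Theorems.FrobeniusClosingPatchingRelPerfectDepthOneTargets
import Literature.AlgebraicGeometry.Resolution.ExceptionalDivisorRegularGlobal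
import Literature.AlgebraicGeometry.Resolution.HypersurfacePushforward
import Literature.AlgebraicGeometry.Resolution.KollarPushforward
import Literature.AlgebraicGeometry.Resolution.MonomialMarkedIdeals
import HarnessLib

/-!
# Crux `PatchingRelPerfect` (stmt-ResolutionOfSingularities-16161), chain W5.2 — R4ˢ support:
# the X-side END-GAME of the depth-two rung (two blowing ups principalize the order-one residual)

[OURS · L1 W5.2 · rung tool] Fact-free, any dimension / characteristic / residue field; nothing here is a
statement of the manuscript under review (Hironaka 2017 items are candidates, never premises). res-L1-w52-lead-1
LIT NOTE §4 (2026-08-27) «X-side END-GAME after `Sing = ∅`: … `K = (f̂, u²)` with `f̂` regular transversal to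
`E`: two further blow-ups along the regular surface `V(u, f̂)` and then `V(u′, w)` principalize `K` (chart check:
`[f̂ = z, u = zu′]` gives `(z)`; `[u, f̂ = uw]` gives `u·(w,u)`, then `(u)`) — these centres have `ord_Z K = 1 < 2`
(weight-deficient) but spawn only a depth-one PEELING problem on the new exceptional divisor; the typed R4
package needs this 2-step end-game as its own small target (it is not `DictionaryStepPow 2`)»; plan-1 g6 STEER
(TargetsF2) 05:26:19Z (h)/KERNEL NOTE v1.6 «depth-ONE escaped sub-problems on the weight-1 carriers (r-d1
engine with carrier F_k: D1 holds verbatim)». This file proves it at scheme level, in the unbundled r-d1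
dictionary format of `DepthOne.dictionaryStep_pow` (p497259), for the ORDER-ONE RESIDUAL SHAPE

  `K = H + 𝓘_E²`, `D := V(H + 𝓘_E)` a regular scheme, the host `H` regular ALONG `D`
  (quotient stalks `𝒪_{X,x}/H_x` regular for `x ∈ D` — e.g. `H` locally principal of order one at the
  points of `D`; nothing is asked of `H` away from `D`),

which is the W₂ end state «`ord_x (K|_E) ≤ 1` everywhere» read on the fourfold with a host (the one-form /
retraction formats `K = r^*𝔟 + 𝓘_E²`, `K = 𝓘_{H} + 𝓘_E²` both instantiate it):

* §1 `controlledTransform_sup_controlledTransform_eq_top` — blowing up `C = A + B` SEPARATES the weight-one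
  transforms: `(σ^*A : 𝓖) + (σ^*B : 𝓖) = 𝒪` (cancel the effective Cartier `𝓖 = σ^*C`);
* §2 `controlledTransform_eq_sup_exceptional` — after blowing up `C₁ = H + 𝓘_E` (weight one, `K ⊆ C₁`):
  `K₁ := (σ^*K : 𝓖) = H₁ + 𝓖` (`H₁ = (σ^*H : 𝓖)`), in particular `𝓖 ⊆ K₁`
  (`exceptional_le_controlledTransform`): the DEPTH-ONE format with respect to the new exceptional divisor;
* §3 `isRegular_subscheme_controlledTransform_sup_exceptional` — for `X` regular locally Noetherian, `V(C)`
  regular and `H ⊆ C` regular along `V(C)`, the scheme `V((σ^*H : 𝓖) + 𝓖)` (strict transform of the host ∩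
  exceptional divisor) is REGULAR: at a point `y`, an adapted regular system of parameters `(c, w)` of
  `𝒪_{X,σy}` (nested Matsumura 14.2, `exists_isRsopPart_nested_span_range_eq`), the Rees chart
  `𝒪_{X₁,y} = (𝒪_{X,σy}[(c)/c_i])_𝔴` (`IsBlowup.exists_reesChart_stalk`), `𝓖_y = (c_i)`, `H₁_y = (e_j : j ∈ T)`
  (`IsBlowup.stalkIdeal_controlledTransform_eq_span_chartGen`) and `(c_i, e_T, w)` part of a regular system of
  parameters (`isRsopPart_chartFamily_reesChart`);
* §4 `endGame` — THE END-GAME: `S` regular local, `g : X ⟶ Spec S` a blowing up cosupported at the closed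
  point, `X` Noetherian regular, `i : E ⟶ X` a closed immersion over the closed point, `I𝒪_X = M · K` with `M`
  effective Cartier, `K` of the order-one residual shape ⇒ there is a blowing up `X₂ ⟶ Spec S` cosupported at
  the closed point with `X₂` REGULAR and `I𝒪_{X₂}` LOCALLY PRINCIPAL. Proof = step 1 (blow up `D`, §2) makes
  `V(𝓖)` the carrier of an r-d1 `DepthOneTargets.DepthOneInvariant` with threefold ideal `K₁|_{V(𝓖)}` whose
  subscheme is regular (§3), and step 2 is ONE r-d1 dictionary step `dictionaryStep_holds` (p496477) with that
  centre and new ideal `⊤`, closed by `DepthOneTargets.dictionaryEnd_holds` (p496485);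
* §5 `companion_of_endGame` (D5 `DepthOneTargets.towerContraction_holds`, p496616: `I ∈ 𝒞`) and
  `atomConclusion_of_endGame` (the registered core's binder shape, via `atomConclusion_of_companion'`).

AI-written; AI review is weaker than expert review.

## References

* J. Kollár, *Lectures on Resolution of Singularities* (2007), 3.30.2, (3.111) Step 3. [Kollar2007]
* U. Görtz, T. Wedhorn, *Algebraic Geometry I*, 2nd ed. (2020), Prop. 13.91 (1), Prop. 13.96 (2), p. 416.
  [GortzWedhorn2020]
* E. Bierstone, D. Grigoriev, P. Milman, J. Włodarczyk, *Effective Hironaka resolution and its complexity*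
  (2011), §3.2 Lemma 3.2.1. [BierstoneGrigorievMilmanWlodarczyk2011]
* H. Matsumura, *Commutative Ring Theory* (1986), Thm. 14.2. [Matsumura1987]
* The Stacks Project, Tags 080A, 0804, 0BIQ. [StacksProject]
-/

-- `Summit.<Summit>.<Sub>.Theorems` with `Sub = Summit` (single-conjunct summit, D-0017)
set_option linter.dupNamespace false

noncomputable section

open CategoryTheory CategoryTheory.Limits AlgebraicGeometry TopologicalSpace
open Literature.AlgebraicGeometry.Resolution
open IsLocalRing

namespace Summit.ResolutionOfSingularities.ResolutionOfSingularities.Theorems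

universe u

namespace DepthTwo
/-! ## §4 The end-game: two blowing ups principalize the order-one residual `K = H + 𝓘_E²` -/

/-- **THE X-SIDE END-GAME OF THE DEPTH-TWO RUNG** (r-d1 dictionary format, unbundled). `S` regular local,
`g : X ⟶ Spec S` a blowing up cosupported at the closed point, `X` Noetherian regular, `i : E ⟶ X` a closed
immersion with `E` over the closed point, the FORMAT `I𝒪_X = M · K` with `M` an effective Cartier ideal, and
the ORDER-ONE RESIDUAL SHAPE `K = H + 𝓘_E²` where the host `H` is regular ALONG `D := V(H + 𝓘_E)` (its
quotient stalks there are regular local rings — e.g. `H` locally principal of order one, a regular strict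
transform of a hypersurface of `I`, or the pull-back `r^* 𝔟` of a regular divisor under a retraction) and
`D` is a regular scheme (the W₂ end state «`ord (K|_E) ≤ 1` everywhere» read on `X`). THEN there is a
blowing up `g₂ : X₂ ⟶ Spec S` cosupported at the closed point with `X₂` regular and `I𝒪_{X₂}` locally
principal. Proof: blow up `D` with weight ONE (`ord_D K = 1 < 2`: a weight-deficient centre) — the strict
transforms of `H` and `E` separate and `K₁ = (σ^*K : 𝓖) = H₁ + 𝓖 ⊇ 𝓖` is the DEPTH-ONE format with
respect to the new exceptional divisor `G = V(𝓖)` (`controlledTransform_eq_sup_exceptional`), a regular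
threefold over the closed point; then ONE dictionary step of programme r-d1
(`dictionaryStep_holds`, centre `K₁|_G = 𝓘_{H₁ ∩ G}`, regular by
`isRegular_subscheme_controlledTransform_sup_exceptional`, new threefold ideal `⊤`) and the dictionary's
end (`DepthOneTargets.dictionaryEnd_holds`). Chart check (`K = (f̂, u²)`): `[f̂ = z, u = z u′]` gives `(z)`;
`[u, f̂ = u w]` gives `u · (w, u)`, then `(u)`. Fact-free; any dimension, characteristic and residue field.
[cite: Kollar2007, (3.111) Step 3] [cite: GortzWedhorn2020, Prop. 13.91 (1), Prop. 13.96 (2)]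
[cite: BierstoneGrigorievMilmanWlodarczyk2011, §3.2 Lemma 3.2.1] -/
theorem endGame {S : Type u} [CommRing S] [IsRegularLocalRing S] (I : Ideal S)
    {E X : Scheme.{u}} (i : E ⟶ X) (g : X ⟶ Spec (.of S))
    [IsNoetherian X] (hX : Scheme.IsRegular X) [IsClosedImmersion i]
    (hEpt : ∀ e : E, g.base (i.base e) = IsLocalRing.closedPoint S)
    (hg : ∃ K₀ : (Spec (.of S)).IdealSheafData, IsBlowup g K₀ ∧
      (K₀.support : Set (Spec (.of S))) ⊆ {IsLocalRing.closedPoint S})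
    (M K H : X.IdealSheafData) (hM : IsEffectiveCartier M)
    (hIMK : (affineBlowup.idealSheaf I).comap g = M * K)
    (hK : K = H ⊔ i.ker ^ 2) (hD : Scheme.IsRegular (H ⊔ i.ker).subscheme)
    (hH : ∀ x ∈ (H ⊔ i.ker).support, IsRegularLocalRing (X.presheaf.stalk x ⧸ stalkIdeal H x)) :
    ∃ (X₂ : Scheme.{u}) (g₂ : X₂ ⟶ Spec (.of S)),
      (∃ K₀ : (Spec (.of S)).IdealSheafData, IsBlowup g₂ K₀ ∧
        (K₀.support : Set (Spec (.of S))) ⊆ {IsLocalRing.closedPoint S}) ∧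
      Scheme.IsRegular X₂ ∧ IsLocallyPrincipal ((affineBlowup.idealSheaf I).comap g₂) := by
  classical
  set C : X.IdealSheafData := H ⊔ i.ker with hCdef
  have hHC : H ≤ C := le_sup_left
  have hKC : K ≤ C := by
    rw [hK]
    exact sup_le le_sup_left ((sq_le_self' i.ker).trans le_sup_right)
  -- STEP 1: blow `X` up along `C` (weight one)
  obtain ⟨X₁, σ, hσ⟩ := exists_isBlowup X C
  set G : X₁.IdealSheafData := C.comap σ with hGdef
  have hG : IsEffectiveCartier G := hσ.isEffectiveCartier
  haveI : IsProper σ := hσ.isProper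
  haveI : IsLocallyNoetherian X₁ := LocallyOfFiniteType.isLocallyNoetherian σ
  haveI : CompactSpace X₁ := QuasiCompact.compactSpace_of_compactSpace σ
  have hX₁N : IsNoetherian X₁ := {}
  have hX₁ : Scheme.IsRegular X₁ := hσ.isRegular_of_isRegular_subscheme hX hD
  set K₁ : X₁.IdealSheafData := controlledTransform σ C K 1 with hK₁def
  have hGK₁ : G ≤ K₁ := exceptional_le_controlledTransform hK hσ
  have hK₁eq : K₁ = controlledTransform σ C H 1 ⊔ G := controlledTransform_eq_sup_exceptional hK hσ
  have hK₁reg : Scheme.IsRegular K₁.subscheme := by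
    rw [hK₁eq]
    exact isRegular_subscheme_controlledTransform_sup_exceptional hX hσ hD hHC hH
  -- the new exceptional divisor `G = V(𝓖)` as the carrier of a depth-ONE format
  have hkerG : G.subschemeι.ker = G := Scheme.IdealSheafData.ker_subschemeι G
  have hGreg : Scheme.IsRegular G.subscheme := hσ.isRegular_subscheme_comap hX hD
  have hCE : (C.support : Set X) ⊆ Set.range i.base := by
    intro x hx
    have hx' : x ∈ (i.ker.support : Set X) := Scheme.IdealSheafData.support_antitone le_sup_right hx
    rw [Scheme.Hom.support_ker, i.isClosedEmbedding.isClosed_range.closure_eq] at hx'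
    exact hx'
  have hCpt : (C.support : Set X) ⊆ g.base ⁻¹' {IsLocalRing.closedPoint S} := by
    intro x hx
    obtain ⟨e, rfl⟩ := hCE hx
    exact hEpt e
  have hGpt : ∀ p : G.subscheme,
      (σ ≫ g).base (G.subschemeι.base p) = IsLocalRing.closedPoint S := by
    intro p
    have h1 : G.subschemeι.base p ∈ ((C.comap σ).support : Set X₁) := by
      rw [← hGdef, ← Scheme.IdealSheafData.range_subschemeι]
      exact ⟨p, rfl⟩
    rw [Scheme.IdealSheafData.support_comap] at h1
    have h2 : g.base (σ.base (G.subschemeι.base p)) = IsLocalRing.closedPoint S := hCpt h1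
    simpa only [Scheme.Hom.comp_base, TopCat.coe_comp, Function.comp_apply] using h2
  have hg₁ : ∃ Q : (Spec (.of S)).IdealSheafData, IsBlowup (σ ≫ g) Q ∧
      (Q.support : Set (Spec (.of S))) ⊆ {IsLocalRing.closedPoint S} := by
    obtain ⟨K₀, hgK, hKsupp⟩ := hg
    exact hgK.exists_isBlowup_comp_supported g K₀ σ C {IsLocalRing.closedPoint S} hKsupp hσ hCpt
  have hM₁ : IsEffectiveCartier (M.comap σ * G) := (hM.comap_of_isBlowup hσ).mul hG
  have hfmt : (affineBlowup.idealSheaf I).comap (σ ≫ g) = (M.comap σ * G) * K₁ := by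
    rw [Scheme.IdealSheafData.comap_comp, hIMK, comap_mul, ← hσ.comap_mul_controlledTransform_one hKC,
      mul_assoc]
  have hinv : DepthOneTargets.DepthOneInvariant S I G.subscheme X₁ G.subschemeι (σ ≫ g)
      (K₁.comap G.subschemeι) :=
    { isNoetherian := hX₁N
      isRegular := hX₁
      isRegular_exc := hGreg
      isClosedImmersion := inferInstance
      isEffectiveCartier_ker := by rw [hkerG]; exact hG
      map_eq_closedPoint := hGpt
      exists_isBlowup_supported := hg₁
      exists_format := ⟨M.comap σ * G, K₁, hM₁, by rw [hkerG]; exact hGK₁, rfl, hfmt⟩ }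
  -- STEP 2: one dictionary step of programme r-d1 with centre `K₁|_G` (regular), new ideal `⊤`
  have hcentre : Scheme.IsRegular (K₁.comap G.subschemeι).subscheme := by
    rw [← isRegular_subscheme_map_iff_of_isClosedImmersion G.subschemeι (K₁.comap G.subschemeι),
      map_comap_of_ker_le K₁ G.subschemeι (by rw [hkerG]; exact hGK₁)]
    exact hK₁reg
  obtain ⟨G', τ, hτ⟩ := exists_isBlowup G.subscheme (K₁.comap G.subschemeι)
  obtain ⟨X₂, i₂, g₂, hinv₂⟩ := dictionaryStep_holds S I G.subscheme X₁ G.subschemeι (σ ≫ g)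
    (K₁.comap G.subschemeι) hinv G' τ (K₁.comap G.subschemeι) ⊤ hcentre le_rfl hτ
    (by rw [Scheme.IdealSheafData.mul_top])
  exact ⟨X₂, g₂, hinv₂.exists_isBlowup_supported, hinv₂.isRegular,
    DepthOneTargets.dictionaryEnd_holds S I G' X₂ i₂ g₂ ⊤ hinv₂ (Or.inl rfl)⟩

/-! ## §5 Corollaries in the chain's formats: companion class `𝒞` and the core's binder shape -/

/-- **The end-game lands `I` in the companion class `𝒞`** (D5 `towerContraction_holds` on the output of
`endGame`): there are an `𝔪`-primary (or unit) `Q` and a REGULAR blowing up of `Spec S` along `I · Q`.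
[cite: StacksProject, Tag 080A] [cite: Kollar2007, (3.111) Step 3] -/
theorem companion_of_endGame {S : Type u} [CommRing S] [IsRegularLocalRing S] {I : Ideal S} (hI : I ≠ ⊥)
    {E X : Scheme.{u}} (i : E ⟶ X) (g : X ⟶ Spec (.of S))
    [IsNoetherian X] (hX : Scheme.IsRegular X) [IsClosedImmersion i]
    (hEpt : ∀ e : E, g.base (i.base e) = IsLocalRing.closedPoint S)
    (hg : ∃ K₀ : (Spec (.of S)).IdealSheafData, IsBlowup g K₀ ∧
      (K₀.support : Set (Spec (.of S))) ⊆ {IsLocalRing.closedPoint S})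
    (M K H : X.IdealSheafData) (hM : IsEffectiveCartier M)
    (hIMK : (affineBlowup.idealSheaf I).comap g = M * K)
    (hK : K = H ⊔ i.ker ^ 2) (hD : Scheme.IsRegular (H ⊔ i.ker).subscheme)
    (hH : ∀ x ∈ (H ⊔ i.ker).support, IsRegularLocalRing (X.presheaf.stalk x ⧸ stalkIdeal H x)) :
    ∃ (Q : Ideal S) (m : ℕ), IsLocalRing.maximalIdeal S ^ m ≤ Q ∧
      ∃ (B : Scheme.{u}) (b : B ⟶ Spec (.of S)),
        IsBlowup b (affineBlowup.idealSheaf (I * Q)) ∧ Scheme.IsRegular B := by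
  obtain ⟨X₂, g₂, ⟨K₀, hg₂, hK₀⟩, hX₂, hlp⟩ := endGame I i g hX hEpt hg M K H hM hIMK hK hD hH
  exact DepthOneTargets.towerContraction_holds S I hI X₂ g₂ K₀ hg₂ hK₀ hX₂ hlp

/-- **The end-game in the registered core's binder shape** (`stub_atomDimFourBlowup`'s conclusion, via
`atomConclusion_of_companion'`): for `I ≠ 0` whose closed-point modification `g : X ⟶ Spec S` carries the
order-one residual shape of `endGame`, EVERY blowing up `T ⟶ Spec S` along `I` carries a non-zero ideal sheaf
cosupported in the closed fibre whose blowing up is regular. NOT a statement of the manuscript under review.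
[cite: StacksProject, Tag 080A] [cite: Kollar2007, (3.111) Step 3] -/
theorem atomConclusion_of_endGame {S : Type u} [CommRing S] [IsRegularLocalRing S] {I : Ideal S}
    (hI : I ≠ ⊥) {E X : Scheme.{u}} (i : E ⟶ X) (g : X ⟶ Spec (.of S))
    [IsNoetherian X] (hX : Scheme.IsRegular X) [IsClosedImmersion i]
    (hEpt : ∀ e : E, g.base (i.base e) = IsLocalRing.closedPoint S)
    (hg : ∃ K₀ : (Spec (.of S)).IdealSheafData, IsBlowup g K₀ ∧
      (K₀.support : Set (Spec (.of S))) ⊆ {IsLocalRing.closedPoint S})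
    (M K H : X.IdealSheafData) (hM : IsEffectiveCartier M)
    (hIMK : (affineBlowup.idealSheaf I).comap g = M * K)
    (hK : K = H ⊔ i.ker ^ 2) (hD : Scheme.IsRegular (H ⊔ i.ker).subscheme)
    (hH : ∀ x ∈ (H ⊔ i.ker).support, IsRegularLocalRing (X.presheaf.stalk x ⧸ stalkIdeal H x))
    (T : Scheme.{u}) (f : T ⟶ Spec (.of S)) (hf : IsBlowup f (affineBlowup.idealSheaf I)) :
    ∃ (J : T.IdealSheafData) (T' : Scheme.{u}) (π : T' ⟶ T), J ≠ ⊥ ∧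
      (∀ t : T, t ∈ J.support → f.base t = IsLocalRing.closedPoint S) ∧
      IsBlowup π J ∧ Scheme.IsRegular T' :=
  atomConclusion_of_companion' hI (companion_of_endGame hI i g hX hEpt hg M K H hM hIMK hK hD hH) T f hf

/-! ## §6 The simple-normal-crossings reading (plan-1 RATIFY 05:42:24Z: «for general ℓ the end-game is M2
with 𝒦 = [exps of r^*𝔟′, (𝓘_E′, ℓ)]»; the case ℓ = 2, 𝒦 = [[(H, 1)], [(𝓘_E, 2)]]) -/

/-- **The end-game from simple normal crossings of the pair `{H, 𝓘_E}`**: if the host `H` and the ideal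
`𝓘_E` of the exceptional divisor have simultaneous simple normal crossings on `X` (`HasSNC [H, 𝓘_E]`: at
each point a regular system of parameters in which each of the two through the point is a coordinate), then
`V(H + 𝓘_E)` is regular and `H` is regular along it, so `endGame` applies to `K = H + 𝓘_E²` — the `ℓ = 2`
case of the monomial reading `K = monomialSum [[(H,1)],[(𝓘_E,2)]]` of TargetsF3. [cite: Kollar2007, (3.111) Step 3] -/
theorem endGame_of_hasSNC {S : Type u} [CommRing S] [IsRegularLocalRing S] (I : Ideal S)
    {E X : Scheme.{u}} (i : E ⟶ X) (g : X ⟶ Spec (.of S))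
    [IsNoetherian X] (hX : Scheme.IsRegular X) [IsClosedImmersion i]
    (hEpt : ∀ e : E, g.base (i.base e) = IsLocalRing.closedPoint S)
    (hg : ∃ K₀ : (Spec (.of S)).IdealSheafData, IsBlowup g K₀ ∧
      (K₀.support : Set (Spec (.of S))) ⊆ {IsLocalRing.closedPoint S})
    (M K H : X.IdealSheafData) (hM : IsEffectiveCartier M)
    (hIMK : (affineBlowup.idealSheaf I).comap g = M * K)
    (hK : K = H ⊔ i.ker ^ 2) (hsnc : HasSNC [H, i.ker]) :
    ∃ (X₂ : Scheme.{u}) (g₂ : X₂ ⟶ Spec (.of S)),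
      (∃ K₀ : (Spec (.of S)).IdealSheafData, IsBlowup g₂ K₀ ∧
        (K₀.support : Set (Spec (.of S))) ⊆ {IsLocalRing.closedPoint S}) ∧
      Scheme.IsRegular X₂ ∧ IsLocallyPrincipal ((affineBlowup.idealSheaf I).comap g₂) := by
  classical
  haveI : IsLocallyNoetherian X := inferInstance
  have hD : Scheme.IsRegular (H ⊔ i.ker).subscheme := by
    have h := hsnc.isRegular_subscheme_finsetSup {H, i.ker} (fun L hL => by
      simp only [Finset.mem_insert, Finset.mem_singleton] at hL
      rcases hL with rfl | rfl <;> simp)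
    simpa only [Finset.sup_insert, Finset.sup_singleton, id] using h
  have hHreg : Scheme.IsRegular H.subscheme := by
    have h := hsnc.isRegular_subscheme_finsetSup {H} (fun L hL => by
      simp only [Finset.mem_singleton] at hL
      subst hL; simp)
    simpa only [Finset.sup_singleton, id] using h
  refine endGame I i g hX hEpt hg M K H hM hIMK hK hD fun x hx => ?_
  exact isRegularLocalRing_stalk_quotient_stalkIdeal hHreg
    (Scheme.IdealSheafData.support_antitone le_sup_left hx)

end DepthTwo

end Summit.ResolutionOfSingularities.ResolutionOfSingularities.Theorems

end
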